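import Summits.Ventures.PercRepro.RankLevelSetHallTight

/-!
# PercRepro — C-044: THE FRACTIONAL Φ-MATCHING (HALL) FORMS OF C-025, TYPED (p10, gen 10, on night-1 g12's row;
the Lean seat assigned at CONJECTURES.md v377 / RULING (um)(77))

ROW C-044 (night-1 g12, the text of record): `M` a finite matroid, `q + 2 ≤ p`; `𝒵 = {Z ⊆ E : r(Z) = q, r(E ∖ Z) = p}`
(`cellMembers`), `Y = {S ⊆ E : q < r(S) < p}` (`cellY`); UP: `Z ~ S` iff `Z ⊆ S`; DOWN: iff `S ⊆ E ∖ Z`.  CONJECTURE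
(each form): a fractional matching giving every `Z` weight `Φ(p,q)` with every `S` loaded at most `1` exists —
equivalently (Hall) every `𝒜 ⊆ 𝒵` has at least `Φ(p,q)·#𝒜` neighbours in `Y`.  THIS FILE types the two HALL
conditions as `Prop`s (`HallUpC025`, `HallDownC025`; NOT asserted), proves that each implies `C025` in one line
(`𝒜 = 𝒵`; `#𝒵 = #U(p,q)` by complementation, `Y ⊇ N(𝒵)`), and records the DOWN form at the tight layer
`#E = p + q` as night-1's theorem (`hallDown_of_ncard_eq`, from `hall_down_of_ncard_eq` p427580).  The
max-flow / Hall equivalence itself is not typed (the fractional matching is the Hall condition by König–Hall, a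
classical statement outside this file).

* `cellMembers`, `cellY`, `upNbhd`, `downNbhd`;
* `ncard_cellMembers_eq` (`#𝒵 = #U(p,q)`, the complement bijection);
* `HallUpC025`, `HallDownC025` (DEFs, the two conjectures);
* **`c025_of_hallUp`**, **`c025_of_hallDown`** (each form implies `C025`);
* `hallDown_of_ncard_eq` (the DOWN Hall condition at `#E = p + q`, night-1's theorem in this vocabulary).
-/

namespace PercRepro

open Set Matroid

variable {α : Type} {M : Matroid α} [M.Finite]

/-- The members of the cell `(p, q)`: `Z ⊆ E` with `r(Z) = q` and `r(E ∖ Z) = p` (the complements of the sets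
`U(p,q)` of `C025`). -/
def cellMembers (M : Matroid α) (p q : ℕ) : Set (Set α) :=
  {Z : Set α | Z ⊆ M.E ∧ M.eRk Z = (q : ℕ∞) ∧ M.eRk (M.E \ Z) = (p : ℕ∞)}

/-- The sets of `Y(p,q)`: `q < r(S) < p`. -/
def cellY (M : Matroid α) (p q : ℕ) : Set (Set α) :=
  {S : Set α | S ⊆ M.E ∧ (q : ℕ∞) < M.eRk S ∧ M.eRk S < (p : ℕ∞)}

/-- The UP-neighbourhood of a family of members: the `S ∈ Y` containing some member. -/
def upNbhd (M : Matroid α) (p q : ℕ) (𝒜 : Set (Set α)) : Set (Set α) :=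
  {S : Set α | S ⊆ M.E ∧ (q : ℕ∞) < M.eRk S ∧ M.eRk S < (p : ℕ∞) ∧ ∃ Z ∈ 𝒜, Z ⊆ S}

/-- The DOWN-neighbourhood of a family of members: the `S ∈ Y` contained in the complement of some member. -/
def downNbhd (M : Matroid α) (p q : ℕ) (𝒜 : Set (Set α)) : Set (Set α) :=
  {S : Set α | S ⊆ M.E ∧ (q : ℕ∞) < M.eRk S ∧ M.eRk S < (p : ℕ∞) ∧ ∃ Z ∈ 𝒜, S ⊆ M.E \ Z}

omit [M.Finite] in
/-- The UP-neighbourhood lies in `Y`. -/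
theorem upNbhd_subset_cellY (𝒜 : Set (Set α)) (p q : ℕ) : upNbhd M p q 𝒜 ⊆ cellY M p q := by
  intro S hS
  exact ⟨hS.1, hS.2.1, hS.2.2.1⟩

omit [M.Finite] in
/-- The DOWN-neighbourhood lies in `Y`. -/
theorem downNbhd_subset_cellY (𝒜 : Set (Set α)) (p q : ℕ) : downNbhd M p q 𝒜 ⊆ cellY M p q := by
  intro S hS
  exact ⟨hS.1, hS.2.1, hS.2.2.1⟩

/-- `Y` is finite (a family of subsets of the finite ground set). -/
theorem cellY_finite (M : Matroid α) [M.Finite] (p q : ℕ) : (cellY M p q).Finite :=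
  M.ground_finite.finite_subsets.subset (fun _ hS => hS.1)

omit [M.Finite] in
/-- **The complement bijection**: `#𝒵 = #U(p,q)`. -/
theorem ncard_cellMembers_eq (M : Matroid α) (p q : ℕ) :
    (cellMembers M p q).ncard =
      {A : Set α | A ⊆ M.E ∧ M.eRk A = (p : ℕ∞) ∧ M.eRk (M.E \ A) = (q : ℕ∞)}.ncard := by
  apply Set.ncard_congr (fun Z _ => M.E \ Z)
  · intro Z hZ
    obtain ⟨hZE, hZq, hZp⟩ := hZ
    refine ⟨sdiff_subset, hZp, ?_⟩
    rw [sdiff_sdiff_cancel_left hZE]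
    exact hZq
  · intro Z₁ Z₂ h₁ h₂ h
    have := congrArg (fun T => M.E \ T) h
    simpa only [sdiff_sdiff_cancel_left h₁.1, sdiff_sdiff_cancel_left h₂.1] using this
  · intro A hA
    obtain ⟨hAE, hAp, hAq⟩ := hA
    refine ⟨M.E \ A, ⟨sdiff_subset, hAq, ?_⟩, sdiff_sdiff_cancel_left hAE⟩
    rw [sdiff_sdiff_cancel_left hAE]
    exact hAp

/-- **C-044, UP FORM** (a `Prop`; NOT asserted): for every finite matroid, every cell `q + 2 ≤ p` and every
subfamily `𝒜` of members, `Φ(p,q)·#𝒜 ≤ #(UP-neighbourhood of 𝒜)`. -/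
def HallUpC025 : Prop :=
  ∀ {α : Type} (M : Matroid α) [M.Finite] (p q : ℕ), q + 2 ≤ p → ∀ 𝒜 ⊆ cellMembers M p q,
    phiK p q * (𝒜.ncard : ℚ) ≤ ((upNbhd M p q 𝒜).ncard : ℚ)

/-- **C-044, DOWN FORM** (a `Prop`; NOT asserted): the same with the DOWN-neighbourhood. -/
def HallDownC025 : Prop :=
  ∀ {α : Type} (M : Matroid α) [M.Finite] (p q : ℕ), q + 2 ≤ p → ∀ 𝒜 ⊆ cellMembers M p q,
    phiK p q * (𝒜.ncard : ℚ) ≤ ((downNbhd M p q 𝒜).ncard : ℚ)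

/-- **Each form implies C-025** — the UP form: take `𝒜 = 𝒵`. -/
theorem c025_of_hallUp (h : HallUpC025) : C025 := by
  intro α M _ p q hpq
  have h1 := h M p q hpq (cellMembers M p q) (subset_refl _)
  rw [ncard_cellMembers_eq] at h1
  refine h1.trans ?_
  exact_mod_cast Set.ncard_le_ncard (upNbhd_subset_cellY _ p q) (cellY_finite M p q)

/-- **Each form implies C-025** — the DOWN form: take `𝒜 = 𝒵`. -/
theorem c025_of_hallDown (h : HallDownC025) : C025 := by
  intro α M _ p q hpq
  have h1 := h M p q hpq (cellMembers M p q) (subset_refl _)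
  rw [ncard_cellMembers_eq] at h1
  refine h1.trans ?_
  exact_mod_cast Set.ncard_le_ncard (downNbhd_subset_cellY _ p q) (cellY_finite M p q)

/-- **The DOWN Hall condition at the tight layer** `#E = p + q` (night-1 g12, `hall_down_of_ncard_eq`, in this
file's vocabulary): every subfamily of members has at least `Φ(p,q)·#𝒜` DOWN-neighbours. -/
theorem hallDown_of_ncard_eq (p q : ℕ) (hE : M.E.ncard = p + q) (𝒜 : Set (Set α))
    (h𝒜 : 𝒜 ⊆ cellMembers M p q) :
    phiK p q * (𝒜.ncard : ℚ) ≤ ((downNbhd M p q 𝒜).ncard : ℚ) :=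
  hall_down_of_ncard_eq M p q hE 𝒜 (fun _ hZ => h𝒜 hZ)

end PercRepro
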